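import Summits.HubbardSuperconductivity.HubbardSuperconductivity.Theorems.SgCorridor.Negative.AnchorFreezeModel

/-!
# `SgCorridor` (stmt-HubbardSuperconductivity-16274, route `ColourTheSpin`) — negative side:
# link functions with an ODD number of transporter factors have no electric-vacuum component

The `Z₂`-CENTRE SUPERSELECTION RULE behind the verdict that the `B1g` corridor of route `ColourTheSpin`
is empty at EVERY strong-coupling anchor (the typed one, refuted by link freezing in
`AnchorFreeze*.lean`, and its repairs: one-point anchor, `g`-dependent constants, Gauss-law typing).

The centre `-1 = a²` of `Q8` (coded `(0, 2)` in the route's `Fin 2 × ZMod 4` model) is represented by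
`ρ(-1) = -1`, so every matrix coefficient of the inlined transporter `ρ = rQ` is ODD under
`u ↦ (-1)·u` (`rQ_centre_mul`), and so is every product of an odd number of such coefficients or their
conjugates — the link-`b` weight produced by an odd number of traversals of `b` (hops `c†ρ(k_b)c`,
reverse hops, and the pair field's own factor `(ερ(k_b))_{στ} = ±ρ(k_b)_{σ'τ}`). Since `u ↦ (-1)·u`
is a bijection of `Q8`, every odd function has ZERO `Q8`-average (`sum_eq_zero_of_centre_odd`): such a
link weight is orthogonal to the constant link function, i.e. to the electric vacuum. Consequences
(prose; the lattice bookkeeping is elementary): a product of hops and one bond pair field `Δ_b`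
returns every link to the vacuum only if every link is crossed an EVEN number of times (counting
`Δ_b`'s factor as one crossing of `b`), hence preserves the fermion-number parity of every site; an
operator removing two fermions while preserving all site parities removes them from ONE site. So the
flux-free (low-energy) part of the dressed gauge-covariant bond pair field is a field of ON-SITE pair
annihilators at the bond ends, to all orders in `t/g²` — and the route's `B1g` form factor annihilates
every such field identically (`SgCorridorNegative.dWave_bondSum_onsite_eq_zero`,
`Negative/B1gFormFactorOnsiteBlind.lean`). The `n = 1` case is the Elitzur input `Σ_u ρ(u) = 0`
(`SgAnchorFreeze.sum_rQ`) of the freezing refutation; this file is its all-orders extension.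

* `mQ_centre_centre`, `rQ_centre_mul` — `(-1)·((-1)·u) = u`, `ρ((-1)·u)_{στ} = -ρ(u)_{στ}` for the
  verbatim `mQ`, `rQ` of `AnchorFreezeModel.lean` (reused, not redeclared);
* `sum_eq_zero_of_centre_odd` — `(∀ u, f((-1)·u) = -f(u)) → Σ_u f(u) = 0`;
* `sum_prod_rQ_eq_zero_of_odd` — `Σ_u Π_{i < n} ρ(u)^{(⋆ᵢ)}_{σᵢτᵢ} = 0` for every ODD `n`, every choice
  of indices and of conjugations;
* `sum_rQ_mul_rQ_mul_rQ` — the `n = 3` instance spelled out.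

Elementary (finite group averaging); folklore. Refuter cdisprove, 2026-08-17.
-/

noncomputable section

namespace Summit.HubbardSuperconductivity.SgCorridorNegative

open Finset
open Summit.HubbardSuperconductivity.HubbardSuperconductivity.Theorems.SgAnchorFreeze

/-- The coded centre element `-1 = a² = (0, 2)` of `Q8` acts by `u ↦ (u.1, u.2 + 2)`. [folklore] -/
theorem mQ_centre_apply (u : Q) : mQ (0, 2) u = (u.1, u.2 + 2) := by
  revert u
  decide

/-- `(-1)·((-1)·u) = u` in the coded `Q8` (`2 + 2 = 0` in `ZMod 4`). [folklore] -/
theorem mQ_centre_centre (u : Q) : mQ (0, 2) (mQ (0, 2) u) = u := by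
  revert u
  decide

/-- `z ^ (m + 2).val = -(z ^ m.val)` for a fourth root of unity `z` with `z² = -1` (`z = ±I`).
[folklore] -/
theorem pow_val_add_two {z : ℂ} (h4 : z ^ 4 = 1) (h2 : z ^ 2 = -1) (m : ZMod 4) :
    z ^ (m + 2).val = -(z ^ m.val) := by
  rw [ZMod.val_add, show (2 : ZMod 4).val = 2 from rfl, ← pow_eq_pow_mod _ h4, pow_add, h2]
  ring

/-- **`ρ(-1) = -1`**: every coefficient of the inlined transporter is odd under the centre,
`ρ((-1)·u)_{στ} = -ρ(u)_{στ}`. [folklore] -/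
theorem rQ_centre_mul (u : Q) (σ τ : Fin 2) : rQ (mQ (0, 2) u) σ τ = -rQ u σ τ := by
  rw [mQ_centre_apply]
  obtain ⟨a, n⟩ := u
  have hI4 : Complex.I ^ 4 = 1 := Complex.I_pow_four
  have hIsq : Complex.I ^ 2 = -1 := Complex.I_sq
  have hnI4 : (-Complex.I) ^ 4 = 1 := by rw [neg_pow, Complex.I_pow_four]; norm_num
  have hnIsq : (-Complex.I) ^ 2 = -1 := by rw [neg_pow, Complex.I_sq]; norm_num
  have k1 := pow_val_add_two hI4 hIsq n
  have k2 := pow_val_add_two hnI4 hnIsq n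
  unfold rQ
  fin_cases a <;> fin_cases σ <;> fin_cases τ <;> simp [k1, k2]

/-- **Odd functions on `Q8` average to zero**: if `f((-1)·u) = -f(u)` for all `u` then `Σ_u f(u) = 0`
(reindex the sum by the involution `u ↦ (-1)·u`). [folklore] -/
theorem sum_eq_zero_of_centre_odd {f : Q → ℂ} (hf : ∀ u, f (mQ (0, 2) u) = -f u) :
    ∑ u : Q, f u = 0 := by
  have hinv : Function.Involutive (mQ ((0 : Fin 2), (2 : ZMod 4))) := mQ_centre_centre
  have h1 : ∑ u : Q, f (mQ (0, 2) u) = ∑ u : Q, f u :=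
    Equiv.sum_comp hinv.toPerm f
  have h2 : ∑ u : Q, f (mQ (0, 2) u) = -∑ u : Q, f u := by
    rw [← Finset.sum_neg_distrib]
    exact Finset.sum_congr rfl fun u _ => hf u
  have h3 : ∑ u : Q, f u = -∑ u : Q, f u := h1.symm.trans h2
  linear_combination (1 / 2 : ℂ) * h3

/-- **Products of an ODD number of transporter coefficients (each possibly conjugated) average to
zero over `Q8`** — a link crossed an odd number of times never returns to the electric vacuum.
`idx i` are the spin indices of the `i`-th factor, `cj i` says whether it is conjugated (reverse
traversal). [folklore] -/
theorem sum_prod_rQ_eq_zero_of_odd {n : ℕ} (hn : Odd n) (idx : Fin n → Fin 2 × Fin 2)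
    (cj : Fin n → Bool) :
    ∑ u : Q, ∏ i : Fin n,
      (if cj i then (starRingEnd ℂ) (rQ u (idx i).1 (idx i).2) else rQ u (idx i).1 (idx i).2) = 0 := by
  apply sum_eq_zero_of_centre_odd
  intro u
  have hfac : ∀ i : Fin n,
      (if cj i then (starRingEnd ℂ) (rQ (mQ (0, 2) u) (idx i).1 (idx i).2)
        else rQ (mQ (0, 2) u) (idx i).1 (idx i).2) =
      -(if cj i then (starRingEnd ℂ) (rQ u (idx i).1 (idx i).2) else rQ u (idx i).1 (idx i).2) := by
    intro i
    rw [rQ_centre_mul]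
    split_ifs <;> simp
  rw [Finset.prod_congr rfl fun i _ => hfac i, Finset.prod_neg, Finset.card_univ, Fintype.card_fin,
    hn.neg_one_pow]
  ring

/-- The `n = 3` instance, spelled out: `Σ_u ρ(u)_{σ₁τ₁} ρ(u)_{σ₂τ₂} ρ(u)_{σ₃τ₃} = 0` (e.g. the pair
field's factor together with a double traversal of the same link in the same direction never
reaches the vacuum — unlike the even case `Σ_u conj(ρ_{στ}) ρ_{σ'τ'} = 4 δδ`). [folklore] -/
theorem sum_rQ_mul_rQ_mul_rQ (σ₁ τ₁ σ₂ τ₂ σ₃ τ₃ : Fin 2) :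
    ∑ u : Q, rQ u σ₁ τ₁ * rQ u σ₂ τ₂ * rQ u σ₃ τ₃ = 0 := by
  apply sum_eq_zero_of_centre_odd
  intro u
  rw [rQ_centre_mul, rQ_centre_mul, rQ_centre_mul]
  ring

end Summit.HubbardSuperconductivity.SgCorridorNegative

end
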